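import Summits.BirchSwinnertonDyer.Rank1Residual.Supersingular.TamParityChi8Link
import Literature.NumberTheory.EllipticCurves.BSDRootNumberOddParityProofs
import HarnessLib

/-!
# Route `AlignedTransportAtTwo`, crux C2 `MainConjectureOfRankZeroBSDAtTwo` (stmt-BirchSwinnertonDyer-22298):
# THE `χ₈`-TWIST OF EVERY CURVE OF THE CUBIC CHEVALLEY ROAD HAS SIGN `−1` — the first cyclotomic layer `ℚ(√2)` always carries a forced zero

HONEST FRAMING (cell `bsd-f1-sign2`, WIDTH-5 attached prover seat `bsd-line-att-p5` gen 32 on line `birth` of the lead `bsd-line-att-p2`;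
`--supports` stmt-BirchSwinnertonDyer-22298, closes nothing; BSD is NOT proved by any of this; the crux C2, its verdict «blocked-on
`Rank1Residual.GreenbergMuConjectureIrreducible`» and every registered stub are untouched). THEOREMS ONLY (no `def`, no named fact, no
`sorry`); the one PRINT input is the Modularity Theorem in the tree's form `exists_isNewformOf` (binder `hmod`), exactly as in the
`b2b` file `Rank1Residual/Supersingular/TamParityChi8Link.lean` whose GOOD-SUPERSINGULAR law (`w(E^{(2)}) = −w(E)` on Tam-odd rows) this
file transports to the GOOD-ORDINARY, OFF-STRATUM habitat of the cubic Chevalley road (att-p5 g24–g32).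

THE LAW. For `W/ℚ` globally minimal with good reduction at `2` (any type) and `∏ c_v` odd, `N_W·|Δ_min| = m²`
(`exists_conductorNorm_mul_abs_minimalDiscriminantInt_eq_sq`, Ogg–Saito + the odd-`c_ℓ` Kodaira types), `N_W` and `Δ_min` are odd, so
**`N_W ≡ |Δ_min| (mod 8)`** (§1) and, by the tree's `rootNumber_quadraticTwist_two` (Murty–Murty Ch. 6 §1 / Atkin–Lehner §6, from `hmod`),
**`w(W^{(2)}) = χ₈(|Δ_min|)·w(W)`** (§2): the sign of the twist by the first cyclotomic layer `ℚ(√2) = ℚ(ζ₈)⁺` FLIPS iff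
`Δ_min ≡ 3, 5 (mod 8)` and is KEPT iff `Δ_min ≡ 1, 7 (mod 8)` (§3). On the road's domain — `Δ_min ≡ 5 (mod 8)` (good ordinary at `2`,
off the Kilford stratum, `2 = 𝔭₁𝔭₂` in `ℚ(β)`), `∏ c_v` odd, `r_an(W) = 0` — this gives **`w(W^{(2)}) = −1`, `L(W^{(2)}, 1) = 0`,
`r_an(W^{(2)})` odd** (§4; the parity half `w = −1 ⇒ r_an odd` is the tree's UNCONDITIONAL `odd_analyticRank_of_rootNumber_eq_neg_one`).

READING for the crux (Iwasawa bookkeeping at `2`, -imc ledger; not typed here): `W^{(2)} = W ⊗ χ₈` and `χ₈` is the character of the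
FIRST LAYER of the cyclotomic `ℤ₂`-extension, so on the whole road `L(W, χ₈, 1) = 0`: the Mazur–Tate–Teitelbaum `2`-adic `L`-function of
`W` vanishes at `T = χ₈(γ) − 1 = −2`, i.e. `(T + 2) ∣ L₂(W, T)` and `λ₂^{an}(W) ≥ 1`; with Greenberg's Euler-characteristic value
`ord₂ f_W(0) = 2·ord₂ #Ẽ(𝔽₂) ∈ {2, 4}` (rank `0`, `Ш₂ = 1`, `∏ c_v` odd, `Δ < 0`) this forces `λ₂(W) ≥ 2` under `μ₂ = 0` — the road's
curves are never `λ`-minimal, and (parity, PRINT) `rank W(ℚ(√2)) ≥ 1`. Crux workfile `CHI8-TWIST-att-p5-g32.md`.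

References: [MurtyMurty1997] Ch. 6 §1; [AtkinLehner1970] §6; [SilvermanAEC2009] C.16 Thm. 16.3; [SilvermanATAEC1994] IV.9 Table 4.1, IV.11.1;
tree: `Rank1Residual/Supersingular/TamParityChi8(Link).lean`, `TamagawaParitySquare.lean` (b2b), `Literature/…/QuadraticTwistTwoLFunctionProofs.lean`,
`Literature/…/BSDRootNumberOddParityProofs.lean`.
-/

set_option linter.dupNamespace false
set_option autoImplicit false

noncomputable section

open scoped Classical

namespace Summit.BirchSwinnertonDyer.BirchSwinnertonDyer.Theorems.AlignedTransportAtTwoOffStratumChi8Twist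

open WeierstrassCurve NumberField Literature.NumberTheory.EllipticCurves Literature.NumberTheory.EllipticCurves.ModularForms
  Summit.BirchSwinnertonDyer.Rank1Residual.Supersingular

variable (W : WeierstrassCurve ℚ) [W.IsElliptic] [W.IsGloballyMinimal]

/-! ## §1 `N_W ≡ |Δ_min| (mod 8)` for `W` good at `2` with `∏ c_v` odd -/

/-- In `ℤ/8`: if `n` and `d` are odd and `n·d` is a square then `n = d`. -/
private theorem zmod8_eq_of_odd_mul_eq_sq : ∀ n d x : ZMod 8,
    (n = 1 ∨ n = 3 ∨ n = 5 ∨ n = 7) → (d = 1 ∨ d = 3 ∨ d = 5 ∨ d = 7) → n * d = x ^ 2 → n = d := by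
  decide

/-- An odd integer is `1, 3, 5` or `7` in `ℤ/8`. [folklore] -/
theorem intCast_zmod_eight_of_odd {n : ℤ} (hn : Odd n) :
    (n : ZMod 8) = 1 ∨ (n : ZMod 8) = 3 ∨ (n : ZMod 8) = 5 ∨ (n : ZMod 8) = 7 := by
  have h8 : n % 8 = 1 ∨ n % 8 = 3 ∨ n % 8 = 5 ∨ n % 8 = 7 := by obtain ⟨k, hk⟩ := hn; omega
  have hn' : (n : ZMod 8) = ((n % 8 : ℤ) : ZMod 8) := by simpa using (ZMod.intCast_mod n 8).symm
  rw [hn']; rcases h8 with h | h | h | h <;> rw [h] <;> decide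

/-- **`N` odd, `Δ` odd, `N·|Δ| = m²` ⇒ `N = |Δ|` in `ℤ/8`.** [folklore] -/
theorem intCast_zmod_eight_eq_of_mul_abs_eq_sq {N Δ m : ℤ} (hN : Odd N) (hΔ : Odd Δ) (hsq : N * |Δ| = m ^ 2) :
    (N : ZMod 8) = ((|Δ| : ℤ) : ZMod 8) := by
  have h8 : (N : ZMod 8) * ((|Δ| : ℤ) : ZMod 8) = ((m : ℤ) : ZMod 8) ^ 2 := by
    have := congrArg (Int.cast : ℤ → ZMod 8) hsq
    push_cast at this ⊢
    exact this
  have habs : Odd |Δ| := by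
    rcases abs_choice Δ with h | h <;> rw [h]
    · exact hΔ
    · exact hΔ.neg
  exact zmod8_eq_of_odd_mul_eq_sq _ _ _ (intCast_zmod_eight_of_odd hN) (intCast_zmod_eight_of_odd habs) h8

/-- **`N_W ≡ |Δ_min| (mod 8)`** (as an equality in `ℤ/8`) for `W/ℚ` globally minimal with good reduction at `2` and `∏ c_v` odd:
`N_W·|Δ_min| = m²` (`exists_conductorNorm_mul_abs_minimalDiscriminantInt_eq_sq`: the odd-`c_ℓ` Kodaira types have `v_ℓ(N) ≡ v_ℓ(Δ_min)
(mod 2)`), and `N_W`, `Δ_min` are odd. [cite: SilvermanATAEC1994, IV.9 Table 4.1 and IV.11.1] -/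
theorem natCast_conductorNorm_zmod_eight_eq_abs_minimalDiscriminantInt (hgood : W.HasGoodReductionAtPrime 2)
    (hodd : Odd W.tamagawaProduct) :
    ((W.conductorNorm ℤ : ℕ) : ZMod 8) = ((|minimalDiscriminantInt W| : ℤ) : ZMod 8) := by
  obtain ⟨m, hm⟩ := exists_conductorNorm_mul_abs_minimalDiscriminantInt_eq_sq W hodd
  -- `Δ_min` is odd (good reduction at `2`; also the tree's `ResidualThetaHabitatAtTwo.odd_minimalDiscriminantInt_of_hasGoodReductionAtPrime_two`)
  have hΔodd : Odd (minimalDiscriminantInt W) := by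
    rcases Int.even_or_odd (minimalDiscriminantInt W) with h | h
    · exact absurd (even_iff_two_dvd.mp h)
        (by exact_mod_cast W.not_dvd_minimalDiscriminantInt_of_hasGoodReductionAtPrime' 2 hgood)
    · exact h
  have h := intCast_zmod_eight_eq_of_mul_abs_eq_sq (odd_intCast_conductorNorm_of_hasGoodReductionAtPrime_two W hgood) hΔodd hm
  rwa [Int.cast_natCast] at h

/-- **`χ₈(N_W) = χ₈(|Δ_min|)`** for `W/ℚ` globally minimal with good reduction at `2` and `∏ c_v` odd. [cite: SilvermanATAEC1994, IV.9 Table 4.1 and IV.11.1] -/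
theorem χ₈_conductorNorm_eq_χ₈_abs_minimalDiscriminantInt (hgood : W.HasGoodReductionAtPrime 2) (hodd : Odd W.tamagawaProduct) :
    ZMod.χ₈ (W.conductorNorm ℤ) = ZMod.χ₈ ((|minimalDiscriminantInt W| : ℤ) : ZMod 8) := by
  rw [natCast_conductorNorm_zmod_eight_eq_abs_minimalDiscriminantInt W hgood hodd]

/-! ## §2 `w(W^{(2)}) = χ₈(|Δ_min|)·w(W)` -/

/-- **THE SIGN OF THE `ℚ(√2)`-TWIST ON TAM-ODD ROWS: `w(W^{(2)}) = χ₈(|Δ_min|)·w(W)`** for `W/ℚ` globally minimal with good reduction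
at `2` and `∏ c_v` odd, from the Modularity Theorem (`hmod`) through the tree's `rootNumber_quadraticTwist_two` (`w(W^{(2)}) = χ₈(N_W)·w(W)`,
Murty–Murty Ch. 6 §1 / Atkin–Lehner §6) and §1. [cite: MurtyMurty1997, Ch. 6 §1] [cite: AtkinLehner1970, §6] -/
theorem rootNumber_quadraticTwist_two_eq_χ₈_abs_minimalDiscriminantInt_mul (hmod : exists_isNewformOf)
    (hgood : W.HasGoodReductionAtPrime 2) (hodd : Odd W.tamagawaProduct) :
    (W.quadraticTwist 2).rootNumber = ZMod.χ₈ ((|minimalDiscriminantInt W| : ℤ) : ZMod 8) * W.rootNumber := by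
  rw [(W.rootNumber_quadraticTwist_two hmod (not_two_dvd_conductorNorm_of_hasGoodReductionAtPrime_two W hgood)
    (hasGoodReductionAt_of_natGenerator_eq_two W hgood)).1, χ₈_conductorNorm_eq_χ₈_abs_minimalDiscriminantInt W hgood hodd]

/-- The conductor of `W^{(2)}` is `64·N_W` (tree's `rootNumber_quadraticTwist_two`, second clause). [cite: AtkinLehner1970, §6] -/
theorem conductorNorm_quadraticTwist_two (hmod : exists_isNewformOf) (hgood : W.HasGoodReductionAtPrime 2) :
    (W.quadraticTwist 2).conductorNorm ℤ = 64 * W.conductorNorm ℤ :=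
  (W.rootNumber_quadraticTwist_two hmod (not_two_dvd_conductorNorm_of_hasGoodReductionAtPrime_two W hgood)
    (hasGoodReductionAt_of_natGenerator_eq_two W hgood)).2

/-! ## §3 The sign FLIPS iff `Δ_min ≡ 3, 5 (mod 8)` and is KEPT iff `Δ_min ≡ 1, 7 (mod 8)` -/

/-- `χ₈(|Δ|) = −1` when `Δ ≡ 5 (mod 8)` (either sign of `Δ`: `|Δ| ≡ 5` or `3`). [folklore] -/
theorem χ₈_abs_eq_neg_one_of_emod_eight_eq_five {Δ : ℤ} (hΔ : Δ % 8 = 5) : ZMod.χ₈ ((|Δ| : ℤ) : ZMod 8) = -1 := by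
  have hd : ∀ z : ℤ, (z : ZMod 8) = ((z % 8 : ℤ) : ZMod 8) := fun z ↦ by simpa using (ZMod.intCast_mod z 8).symm
  rcases abs_choice Δ with h | h <;> rw [h]
  · rw [hd, hΔ]; decide
  · rw [hd, show (-Δ) % 8 = 3 by omega]; decide

/-- `χ₈(|Δ|) = −1` when `Δ ≡ 3 (mod 8)` (either sign of `Δ`: `|Δ| ≡ 3` or `5`). [folklore] -/
theorem χ₈_abs_eq_neg_one_of_emod_eight_eq_three {Δ : ℤ} (hΔ : Δ % 8 = 3) : ZMod.χ₈ ((|Δ| : ℤ) : ZMod 8) = -1 := by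
  have hd : ∀ z : ℤ, (z : ZMod 8) = ((z % 8 : ℤ) : ZMod 8) := fun z ↦ by simpa using (ZMod.intCast_mod z 8).symm
  rcases abs_choice Δ with h | h <;> rw [h]
  · rw [hd, hΔ]; decide
  · rw [hd, show (-Δ) % 8 = 5 by omega]; decide

/-- `χ₈(|Δ|) = 1` when `Δ ≡ 1 (mod 8)` (either sign: `|Δ| ≡ 1` or `7`). [folklore] -/
theorem χ₈_abs_eq_one_of_emod_eight_eq_one {Δ : ℤ} (hΔ : Δ % 8 = 1) : ZMod.χ₈ ((|Δ| : ℤ) : ZMod 8) = 1 := by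
  have hd : ∀ z : ℤ, (z : ZMod 8) = ((z % 8 : ℤ) : ZMod 8) := fun z ↦ by simpa using (ZMod.intCast_mod z 8).symm
  rcases abs_choice Δ with h | h <;> rw [h]
  · rw [hd, hΔ]; decide
  · rw [hd, show (-Δ) % 8 = 7 by omega]; decide

/-- `χ₈(|Δ|) = 1` when `Δ ≡ 7 (mod 8)` (either sign: `|Δ| ≡ 7` or `1`). [folklore] -/
theorem χ₈_abs_eq_one_of_emod_eight_eq_seven {Δ : ℤ} (hΔ : Δ % 8 = 7) : ZMod.χ₈ ((|Δ| : ℤ) : ZMod 8) = 1 := by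
  have hd : ∀ z : ℤ, (z : ZMod 8) = ((z % 8 : ℤ) : ZMod 8) := fun z ↦ by simpa using (ZMod.intCast_mod z 8).symm
  rcases abs_choice Δ with h | h <;> rw [h]
  · rw [hd, hΔ]; decide
  · rw [hd, show (-Δ) % 8 = 1 by omega]; decide

/-- **FLIP on `Δ_min ≡ 5 (mod 8)`** — the domain of the cubic Chevalley road (good ordinary at `2`, off the Kilford stratum, `2 = 𝔭₁𝔭₂` in
`ℚ(β)`) and also of every good-supersingular-at-`2` curve: for `W/ℚ` globally minimal, good at `2`, `∏ c_v` odd, `Δ_min ≡ 5 (mod 8)`: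
`w(W^{(2)}) = −w(W)`. [cite: MurtyMurty1997, Ch. 6 §1] [cite: AtkinLehner1970, §6] -/
theorem rootNumber_quadraticTwist_two_eq_neg_of_minimalDiscriminantInt_emod_eight_eq_five (hmod : exists_isNewformOf)
    (hgood : W.HasGoodReductionAtPrime 2) (hodd : Odd W.tamagawaProduct) (hΔ : minimalDiscriminantInt W % 8 = 5) :
    (W.quadraticTwist 2).rootNumber = -W.rootNumber := by
  rw [rootNumber_quadraticTwist_two_eq_χ₈_abs_minimalDiscriminantInt_mul W hmod hgood hodd,
    χ₈_abs_eq_neg_one_of_emod_eight_eq_five hΔ]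
  ring

/-- **FLIP on `Δ_min ≡ 3 (mod 8)`** (good ordinary at `2`, `ℚ₂(√Δ) = ℚ₂(√3)` ramified): `w(W^{(2)}) = −w(W)` for `W` globally minimal,
good at `2`, `∏ c_v` odd. [cite: MurtyMurty1997, Ch. 6 §1] [cite: AtkinLehner1970, §6] -/
theorem rootNumber_quadraticTwist_two_eq_neg_of_minimalDiscriminantInt_emod_eight_eq_three (hmod : exists_isNewformOf)
    (hgood : W.HasGoodReductionAtPrime 2) (hodd : Odd W.tamagawaProduct) (hΔ : minimalDiscriminantInt W % 8 = 3) :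
    (W.quadraticTwist 2).rootNumber = -W.rootNumber := by
  rw [rootNumber_quadraticTwist_two_eq_χ₈_abs_minimalDiscriminantInt_mul W hmod hgood hodd,
    χ₈_abs_eq_neg_one_of_emod_eight_eq_three hΔ]
  ring

/-- **KEEP on `Δ_min ≡ 1 (mod 8)`** (the Kilford stratum for good ordinary `W`): `w(W^{(2)}) = w(W)` for `W` globally minimal, good at `2`,
`∏ c_v` odd. [cite: MurtyMurty1997, Ch. 6 §1] [cite: AtkinLehner1970, §6] -/
theorem rootNumber_quadraticTwist_two_eq_self_of_minimalDiscriminantInt_emod_eight_eq_one (hmod : exists_isNewformOf)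
    (hgood : W.HasGoodReductionAtPrime 2) (hodd : Odd W.tamagawaProduct) (hΔ : minimalDiscriminantInt W % 8 = 1) :
    (W.quadraticTwist 2).rootNumber = W.rootNumber := by
  rw [rootNumber_quadraticTwist_two_eq_χ₈_abs_minimalDiscriminantInt_mul W hmod hgood hodd,
    χ₈_abs_eq_one_of_emod_eight_eq_one hΔ, one_mul]

/-- **KEEP on `Δ_min ≡ 7 (mod 8)`** (good ordinary at `2`, `ℚ₂(√Δ) = ℚ₂(√−1)` ramified): `w(W^{(2)}) = w(W)` for `W` globally minimal,
good at `2`, `∏ c_v` odd. [cite: MurtyMurty1997, Ch. 6 §1] [cite: AtkinLehner1970, §6] -/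
theorem rootNumber_quadraticTwist_two_eq_self_of_minimalDiscriminantInt_emod_eight_eq_seven (hmod : exists_isNewformOf)
    (hgood : W.HasGoodReductionAtPrime 2) (hodd : Odd W.tamagawaProduct) (hΔ : minimalDiscriminantInt W % 8 = 7) :
    (W.quadraticTwist 2).rootNumber = W.rootNumber := by
  rw [rootNumber_quadraticTwist_two_eq_χ₈_abs_minimalDiscriminantInt_mul W hmod hgood hodd,
    χ₈_abs_eq_one_of_emod_eight_eq_seven hΔ, one_mul]

/-! ## §4 The road's sub-cell: analytic rank `0` ⇒ `w(W^{(2)}) = −1`, `L(W^{(2)}, 1) = 0`, `r_an(W^{(2)})` odd -/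

/-- **ON THE ROAD'S DOMAIN THE `ℚ(√2)`-TWIST HAS SIGN `−1`.** For `W/ℚ` globally minimal, good at `2`, `∏ c_v` odd, `Δ_min ≡ 5 (mod 8)` and
`r_an(W) = 0` (so `w(W) = 1`, UNCONDITIONALLY: `rootNumber_eq_one_of_even_analyticRank`): `w(W^{(2)}) = −1`.
[cite: MurtyMurty1997, Ch. 6 §1] [cite: SilvermanAEC2009, C.16 Thm. 16.3 and remark, p. 451] -/
theorem rootNumber_quadraticTwist_two_eq_neg_one_of_analyticRank_eq_zero (hmod : exists_isNewformOf)
    (hgood : W.HasGoodReductionAtPrime 2) (hodd : Odd W.tamagawaProduct) (hΔ : minimalDiscriminantInt W % 8 = 5)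
    (hr : W.analyticRank = 0) : (W.quadraticTwist 2).rootNumber = -1 := by
  rw [rootNumber_quadraticTwist_two_eq_neg_of_minimalDiscriminantInt_emod_eight_eq_five W hmod hgood hodd hΔ,
    rootNumber_eq_one_of_even_analyticRank (W := W) (by rw [hr]; exact Even.zero)]

/-- **`L(W^{(2)}, 1) = 0` on the road's domain** (`W` globally minimal, good at `2`, `∏ c_v` odd, `Δ_min ≡ 5 (mod 8)`, `r_an(W) = 0`): the sign `−1`
of the functional equation of the twist kills the central value (tree's unconditional `entireLFunction_one_eq_zero_of_rootNumber_eq_neg_one`).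
Iwasawa reading: `W^{(2)} = W ⊗ χ₈` with `χ₈` the character of the first layer `ℚ(√2)` of the cyclotomic `ℤ₂`-extension, so the `2`-adic
`L`-function of `W` vanishes at `T = −2` and `λ₂^{an}(W) ≥ 1`. [cite: SilvermanAEC2009, C.16 Thm. 16.3 and remark, p. 451] [cite: MurtyMurty1997, Ch. 6 §1] -/
theorem entireLFunction_quadraticTwist_two_one_eq_zero_of_analyticRank_eq_zero (hmod : exists_isNewformOf)
    (hgood : W.HasGoodReductionAtPrime 2) (hodd : Odd W.tamagawaProduct) (hΔ : minimalDiscriminantInt W % 8 = 5)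
    (hr : W.analyticRank = 0) : (W.quadraticTwist 2).entireLFunction 1 = 0 :=
  haveI : (W.quadraticTwist (2 : ℚ)).IsElliptic := W.isElliptic_quadraticTwist two_ne_zero
  entireLFunction_one_eq_zero_of_rootNumber_eq_neg_one
    (rootNumber_quadraticTwist_two_eq_neg_one_of_analyticRank_eq_zero W hmod hgood hodd hΔ hr)

/-- **`r_an(W^{(2)})` is ODD (in particular `≥ 1`) on the road's domain** (`W` globally minimal, good at `2`, `∏ c_v` odd, `Δ_min ≡ 5 (mod 8)`,
`r_an(W) = 0`) — unconditionally given `hmod` (tree's `odd_analyticRank_of_rootNumber_eq_neg_one`). Under the parity conjecture (PRINT for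
`p = 2`: Dokchitser–Dokchitser) `rank W(ℚ(√2)) = rank W(ℚ) + rank W^{(2)}(ℚ)` is odd, hence `≥ 1`: the first cyclotomic layer always
carries a point of infinite order or an odd corank of `Ш[2^∞]`. [cite: SilvermanAEC2009, C.16 Thm. 16.3 and remark, p. 451] -/
theorem odd_analyticRank_quadraticTwist_two_of_analyticRank_eq_zero (hmod : exists_isNewformOf)
    (hgood : W.HasGoodReductionAtPrime 2) (hodd : Odd W.tamagawaProduct) (hΔ : minimalDiscriminantInt W % 8 = 5)
    (hr : W.analyticRank = 0) : Odd (W.quadraticTwist 2).analyticRank :=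
  haveI : (W.quadraticTwist (2 : ℚ)).IsElliptic := W.isElliptic_quadraticTwist two_ne_zero
  odd_analyticRank_of_rootNumber_eq_neg_one
    (rootNumber_quadraticTwist_two_eq_neg_one_of_analyticRank_eq_zero W hmod hgood hodd hΔ hr)

/-- **`r_an(W^{(2)}) ≥ 1` on the road's domain.** [cite: SilvermanAEC2009, C.16 Thm. 16.3 and remark, p. 451] -/
theorem analyticRank_quadraticTwist_two_pos_of_analyticRank_eq_zero (hmod : exists_isNewformOf)
    (hgood : W.HasGoodReductionAtPrime 2) (hodd : Odd W.tamagawaProduct) (hΔ : minimalDiscriminantInt W % 8 = 5)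
    (hr : W.analyticRank = 0) : 0 < (W.quadraticTwist 2).analyticRank :=
  (odd_analyticRank_quadraticTwist_two_of_analyticRank_eq_zero W hmod hgood hodd hΔ hr).pos

/-- **The same three conclusions on the RAMIFIED half `Δ_min ≡ 3 (mod 8)` of the off-stratum cell** (where the unit-sign door is void, ODD-BRANCH-att-p5-g31 §5–§6):
`w(W^{(2)}) = −1` for `W` globally minimal, good at `2`, `∏ c_v` odd, `Δ_min ≡ 3 (mod 8)`, `r_an(W) = 0`. [cite: MurtyMurty1997, Ch. 6 §1] -/
theorem rootNumber_quadraticTwist_two_eq_neg_one_of_analyticRank_eq_zero_of_emod_eight_eq_three (hmod : exists_isNewformOf)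
    (hgood : W.HasGoodReductionAtPrime 2) (hodd : Odd W.tamagawaProduct) (hΔ : minimalDiscriminantInt W % 8 = 3)
    (hr : W.analyticRank = 0) : (W.quadraticTwist 2).rootNumber = -1 := by
  rw [rootNumber_quadraticTwist_two_eq_neg_of_minimalDiscriminantInt_emod_eight_eq_three W hmod hgood hodd hΔ,
    rootNumber_eq_one_of_even_analyticRank (W := W) (by rw [hr]; exact Even.zero)]

/-- **… whereas on `Δ_min ≡ 7 (mod 8)` (and on the Kilford stratum `Δ_min ≡ 1 (mod 8)`) the twist keeps the sign `+1`**: for `W` globally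
minimal, good at `2`, `∏ c_v` odd, `Δ_min ≡ 7 (mod 8)`, `r_an(W) = 0`: `w(W^{(2)}) = 1` (so `r_an(W^{(2)})` is even there, given the tree's
`even_analyticRank_iff`). [cite: MurtyMurty1997, Ch. 6 §1] -/
theorem rootNumber_quadraticTwist_two_eq_one_of_analyticRank_eq_zero_of_emod_eight_eq_seven (hmod : exists_isNewformOf)
    (hgood : W.HasGoodReductionAtPrime 2) (hodd : Odd W.tamagawaProduct) (hΔ : minimalDiscriminantInt W % 8 = 7)
    (hr : W.analyticRank = 0) : (W.quadraticTwist 2).rootNumber = 1 := by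
  rw [rootNumber_quadraticTwist_two_eq_self_of_minimalDiscriminantInt_emod_eight_eq_seven W hmod hgood hodd hΔ,
    rootNumber_eq_one_of_even_analyticRank (W := W) (by rw [hr]; exact Even.zero)]

/-! ## §5 (att-p5 g32, appended) The twist by `−2` (`χ₋₈`, the other odd quadratic subfield of `ℚ(ζ₈)`) -/

/-- On Tam-odd rows with `Δ_min ≡ 5 (mod 8)` and `Δ_min < 0` (the road, `2 = 𝔭₁𝔭₂` in `ℚ(β)`): **`N_W ≡ 3 (mod 8)`** (b2b's `emod_eight_of_mul_abs_eq_sq`, no supersingularity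
needed). [cite: SilvermanATAEC1994, IV.9 Table 4.1 and IV.11.1] -/
theorem conductorNorm_emod_eight_eq_three_of_Δ_neg (hgood : W.HasGoodReductionAtPrime 2) (hodd : Odd W.tamagawaProduct)
    (hΔ8 : minimalDiscriminantInt W % 8 = 5) (hΔ : minimalDiscriminantInt W < 0) : (W.conductorNorm ℤ : ℤ) % 8 = 3 := by
  obtain ⟨m, hm⟩ := exists_conductorNorm_mul_abs_minimalDiscriminantInt_eq_sq W hodd
  exact (emod_eight_of_mul_abs_eq_sq (odd_intCast_conductorNorm_of_hasGoodReductionAtPrime_two W hgood) hΔ8 hm).2 hΔ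

/-- On Tam-odd rows with `Δ_min ≡ 5 (mod 8)` and `Δ_min > 0` (totally real `ℚ(β)`): **`N_W ≡ 5 (mod 8)`**. [cite: SilvermanATAEC1994, IV.9 Table 4.1 and IV.11.1] -/
theorem conductorNorm_emod_eight_eq_five_of_Δ_pos (hgood : W.HasGoodReductionAtPrime 2) (hodd : Odd W.tamagawaProduct)
    (hΔ8 : minimalDiscriminantInt W % 8 = 5) (hΔ : 0 < minimalDiscriminantInt W) : (W.conductorNorm ℤ : ℤ) % 8 = 5 := by
  obtain ⟨m, hm⟩ := exists_conductorNorm_mul_abs_minimalDiscriminantInt_eq_sq W hodd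
  exact (emod_eight_of_mul_abs_eq_sq (odd_intCast_conductorNorm_of_hasGoodReductionAtPrime_two W hgood) hΔ8 hm).1 hΔ

/-- **`w(W^{(−2)}) = w(W^{(2)}) = −w(W)` on the `Δ_min < 0` road** (`Δ_min ≡ 5 (mod 8)`, Tam odd, good at `2`): `N_W ≡ 3 (mod 4)`, so the twists by `2` and `−2`
have the same sign (tree's `rootNumber_quadraticTwist_neg_two_eq_of_mod_four_eq_three`, Murty–Murty Ch. 6 §1). Hence BOTH odd quadratic characters `χ₈, χ₋₈` of
`(ℤ/8)^×` flip the sign on the road, while on the `Δ_min > 0` half (`N ≡ 5 (mod 8)`) `χ₋₈` keeps it (next theorem). [cite: MurtyMurty1997, Ch. 6 §1] -/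
theorem rootNumber_quadraticTwist_neg_two_eq_neg_of_Δ_neg (hmod : exists_isNewformOf) (hgood : W.HasGoodReductionAtPrime 2)
    (hodd : Odd W.tamagawaProduct) (hΔ8 : minimalDiscriminantInt W % 8 = 5) (hΔ : minimalDiscriminantInt W < 0) :
    (W.quadraticTwist (-2)).rootNumber = -W.rootNumber := by
  have hN4 : W.conductorNorm ℤ % 4 = 3 := by
    have h := conductorNorm_emod_eight_eq_three_of_Δ_neg W hgood hodd hΔ8 hΔ
    omega
  rw [W.rootNumber_quadraticTwist_neg_two_eq_of_mod_four_eq_three hmod hN4 (hasGoodReductionAt_of_natGenerator_eq_two W hgood),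
    rootNumber_quadraticTwist_two_eq_neg_of_minimalDiscriminantInt_emod_eight_eq_five W hmod hgood hodd hΔ8]

/-- **… whereas on the `Δ_min > 0` half `w(W^{(−2)}) = w(W)`** (`N ≡ 5 (mod 8)`, `N ≡ 1 (mod 4)`: the `−2`-twist reverses the `2`-twist's sign, tree's
`rootNumber_quadraticTwist_neg_two_eq_neg`). [cite: MurtyMurty1997, Ch. 6 §1] -/
theorem rootNumber_quadraticTwist_neg_two_eq_self_of_Δ_pos (hmod : exists_isNewformOf) (hgood : W.HasGoodReductionAtPrime 2)
    (hodd : Odd W.tamagawaProduct) (hΔ8 : minimalDiscriminantInt W % 8 = 5) (hΔ : 0 < minimalDiscriminantInt W) :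
    (W.quadraticTwist (-2)).rootNumber = W.rootNumber := by
  have hN4 : W.conductorNorm ℤ % 4 = 1 := by
    have h := conductorNorm_emod_eight_eq_five_of_Δ_pos W hgood hodd hΔ8 hΔ
    omega
  rw [W.rootNumber_quadraticTwist_neg_two_eq_neg hmod hN4 (hasGoodReductionAt_of_natGenerator_eq_two W hgood),
    rootNumber_quadraticTwist_two_eq_neg_of_minimalDiscriminantInt_emod_eight_eq_five W hmod hgood hodd hΔ8, neg_neg]

/-- **ON THE ROAD'S DOMAIN THE `ℚ(√−2)`-TWIST ALSO HAS SIGN `−1`**: `W` globally minimal, good at `2`, Tam odd, `Δ_min ≡ 5 (mod 8)`, `Δ_min < 0`, `r_an(W) = 0` ⟹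
`w(W^{(−2)}) = −1`, `L(W^{(−2)}, 1) = 0`, `r_an(W^{(−2)})` odd. With §4: over `ℚ(ζ₈) = ℚ(√−1, √2)` the two odd quadratic twists `W^{(2)}, W^{(−2)}` of a road curve both have
odd analytic rank (so, under parity, `rank W(ℚ(ζ₈)) ≥ 2`) — relevant to the roads through `ℚ(i)`-models and the carrier `ℚ(W[2], i)` (PFμ⁺), whose cyclotomic tower starts at `ℚ(ζ₈)`.
[cite: MurtyMurty1997, Ch. 6 §1] [cite: SilvermanAEC2009, C.16 Thm. 16.3 and remark, p. 451] -/
theorem rootNumber_quadraticTwist_neg_two_eq_neg_one_of_analyticRank_eq_zero (hmod : exists_isNewformOf)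
    (hgood : W.HasGoodReductionAtPrime 2) (hodd : Odd W.tamagawaProduct) (hΔ8 : minimalDiscriminantInt W % 8 = 5)
    (hΔ : minimalDiscriminantInt W < 0) (hr : W.analyticRank = 0) :
    (W.quadraticTwist (-2)).rootNumber = -1 ∧ (W.quadraticTwist (-2)).entireLFunction 1 = 0 ∧ Odd (W.quadraticTwist (-2)).analyticRank := by
  haveI : (W.quadraticTwist (-2 : ℚ)).IsElliptic := W.isElliptic_quadraticTwist (by norm_num)
  have hw : (W.quadraticTwist (-2)).rootNumber = -1 := by
    rw [rootNumber_quadraticTwist_neg_two_eq_neg_of_Δ_neg W hmod hgood hodd hΔ8 hΔ,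
      rootNumber_eq_one_of_even_analyticRank (W := W) (by rw [hr]; exact Even.zero)]
  exact ⟨hw, entireLFunction_one_eq_zero_of_rootNumber_eq_neg_one hw, odd_analyticRank_of_rootNumber_eq_neg_one hw⟩

end Summit.BirchSwinnertonDyer.BirchSwinnertonDyer.Theorems.AlignedTransportAtTwoOffStratumChi8Twist

end
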